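import Literature.Barriers.Parity.SiegelZeroDichotomyPairHLProp71Reduce
import Literature.Barriers.Parity.SiegelZeroDichotomyPairHLStepTwo
import Literature.NumberTheory.Sieve.DivisorBound
import HarnessLib

/-!
# Tao–Teräväinen 2022, Proposition 7.1 (i) (`k = 2` chain): `Λ♭`-type sums in progressions

Topic `Literature/Barriers/Parity`, sub-namespace `TaoTeravainen`; a file of the proof DAG of
`Literature.Barriers.Parity.TaoTeravainen2021_prop72_81_pair` (T. Tao, J. Teräväinen, *The
Hardy–Littlewood–Chowla conjecture in the presence of a Siegel zero*, J. London Math. Soc. (2) 106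
(2022), arXiv:2109.06291), **Proposition 7.1 (i)**: "Let `x ≥ 10`, `0 < ε < 1/(10k)`, and
`D = x^{ε₀/(10k)}`. Let `χ (mod q_χ)` be a real character with `q_χ ≤ x^{1/(10k)+ε₀/2}`. Let
`1 ≤ a ≤ q ≤ x^{1/2+1/(50k)}`, let `I ⊂ [1, x]` be an interval, and let `f : ℤ → ℂ` be
`q_χ`-periodic [with `|f| ≤ 1`]. Then
`∑_{n ∈ I, n ≡ a (q)} (χ∗log)♭(n) f((n-a)/q) ≪ (x/q)((a,q)^{3/2} q_χ^{9/2} q^{3/2}/x^{1-ε₀} + x^ε (a,q)²/D^{1/2} + x^{-ε})`."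

We prove the case `k = 2` in the explicit form consumed by Proposition 7.2: for moduli
`q ≤ x^{51/100}`, `(a, q) ≤ H₀`, `q_χ ≤ x^{1/20}`, intervals `I ⊆ [1, 2x]`, the bound is
`C x^{1-c}/q` with `c = c(ε₀) > 0` (`prop71_i`). The proof follows the source: the `t`-integral and
the smoothing/sub-progression reductions (`…Prop71Reduce.lean`), Lemma 3.9
(`…ModifiedExpansion.lean`) giving `X + Y` (`…Prop71Core.lean`), the `Y`-bound by double Abel
summation with Lemma 3.8 (`…Prop71Y.lean`, `…HyperbolaFourier.lean`) and the `X`-bound by Möbius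
inversion, the trivial count for `q₁ > D^{1/2}q_χ²x^{-4ε}` and two Poisson summations otherwise
(`…Prop71X.lean`, `…Prop71Poisson.lean`).

* `abs_hypKD_progression_sum_le` — the bound for one `t = e^v` (all reductions assembled, with the
  smoothing error, before the choice of parameters);
* `prop71_i` — **Proposition 7.1 (i)** for `k = 2`.
  [cite: TaoTeravainen2021, Proposition 7.1 (i)]
-/

noncomputable section

open Finset Real MeasureTheory
open scoped ContDiff Topology

namespace Literature.Barriers.Parity

namespace TaoTeravainen

open Literature.Analysis.Calculus
open Literature.NumberTheory.Sieve (exists_card_divisors_le_mul_rpow)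

variable {q : ℕ}

/-! ### The smoothing error indicator -/

/-- `|1_{[N₁,N₂]}(N) - ψ_I(N)| ≤ 1_{N₁ ≤ N < A+Δ} + 1_{N₂-Δ < N ≤ N₂}` for the cutoff `ψ_I` of
`[A, B]`, `B = max(N₂, A)`, `N₁ ≤ A`, `Δ > 0`. [cite: TaoTeravainen2021, proof of Proposition 7.1
("`ψ_I(y) = 1` whenever `dist(y, ℝ \ I) ≥ x^{1-2ε}`" and "the contribution of those `n` with
`n ≤ x^{1-ε}`")] -/
theorem abs_indicator_sub_plateau_le {N₁ N₂ : ℕ} {A B Δ : ℝ} (hΔ : 0 < Δ) (hA : (N₁ : ℝ) ≤ A)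
    (hB : B = max (N₂ : ℝ) A) (N : ℕ) :
    |(if N₁ ≤ N ∧ N ≤ N₂ then (1 : ℝ) else 0) - plateauProfile A B Δ N| ≤
      (if N₁ ≤ N ∧ (N : ℝ) < A + Δ then (1 : ℝ) else 0) +
        (if (N₂ : ℝ) - Δ < N ∧ N ≤ N₂ then (1 : ℝ) else 0) := by
  have h0 := plateauProfile_nonneg A B Δ N
  have h1 := plateauProfile_le_one A B Δ N
  have hI1 : 0 ≤ (if N₁ ≤ N ∧ (N : ℝ) < A + Δ then (1 : ℝ) else 0) := by positivity
  have hI2 : 0 ≤ (if (N₂ : ℝ) - Δ < N ∧ N ≤ N₂ then (1 : ℝ) else 0) := by positivity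
  have hE1 : |(if N₁ ≤ N ∧ N ≤ N₂ then (1 : ℝ) else 0) - plateauProfile A B Δ N| ≤ 1 := by
    split_ifs
    · rw [abs_of_nonneg (by linarith)]; linarith
    · rw [zero_sub, abs_neg, abs_of_nonneg h0]; exact h1
  by_cases hN1 : N₁ ≤ N
  · by_cases hlt : (N : ℝ) < A + Δ
    · rw [if_pos (show N₁ ≤ N ∧ (N : ℝ) < A + Δ from ⟨hN1, hlt⟩)]; linarith
    · push Not at hlt
      by_cases hN2 : N ≤ N₂
      · by_cases hgt : (N₂ : ℝ) - Δ < N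
        · rw [if_pos (show (N₂ : ℝ) - Δ < N ∧ N ≤ N₂ from ⟨hgt, hN2⟩)]; linarith
        · -- plateau: `A + Δ ≤ N ≤ N₂ - Δ ≤ B - Δ`
          push Not at hgt
          have hBN : (N : ℝ) ≤ B - Δ := by rw [hB]; exact le_trans hgt (by
            have := le_max_left (N₂ : ℝ) A; linarith)
          rw [if_pos ⟨hN1, hN2⟩, plateauProfile_eq_one hΔ ⟨hlt, hBN⟩, sub_self, abs_zero]
          positivity
      · -- `N > N₂` and `N ≥ A + Δ`: both vanish
        push Not at hN2
        have hNB : B ≤ (N : ℝ) := by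
          rw [hB, max_le_iff]
          exact ⟨by exact_mod_cast hN2.le, by linarith⟩
        rw [if_neg (fun h => absurd h.2 (not_le.mpr hN2)), plateauProfile_eq_zero_of_ge hΔ hNB,
          sub_zero, abs_zero]
        positivity
  · -- `N < N₁ ≤ A`: both vanish
    push Not at hN1
    have hNA : (N : ℝ) ≤ A := le_trans (by exact_mod_cast hN1.le) hA
    rw [if_neg (fun h => absurd h.1 (not_le.mpr hN1)), plateauProfile_eq_zero_of_le hΔ hNA,
      sub_zero, abs_zero]
    positivity

/-! ### The bound for one `t` -/

/-- **All reductions assembled, for one `t = e^v`**: with `ψ_I` the cutoff of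
`[A, B]` (`N₁ ≤ A`, `B = max(N₂, A) ≤ M`), `f` `q`-periodic and `1`-bounded, `q₀ = (a,Q₁) q`,
`Q = Q₁ q`,
`|∑_{N₁ ≤ N ≤ N₂, N ≡ a (Q₁)} f((N-a)/Q₁) K̃_v(N)| ≤ (sup_{N ≤ M}|K̃_v|)·(#bad N) + q · (X-part + Y-part)`
where the bad `N` are those of the progression in `[N₁, A+Δ) ∪ (N₂-Δ, N₂]`, and the `X`/`Y`
parts are those of `abs_hypCongrSum_le` with the mixed-difference sum bounded by
`sum_norm_mixedDiff_hypWeightC_le`. [cite: TaoTeravainen2021, proof of Proposition 7.1] -/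
theorem abs_hypKD_progression_sum_le (χ : DirichletCharacter ℂ q) [NeZero q] {φ : ℝ → ℝ}
    (hφ : IsBump φ) {B₁ B₂ : ℝ} (hB₁ : ∀ u, |deriv φ u| ≤ B₁) (hB₂ : ∀ u, |deriv (deriv φ) u| ≤ B₂)
    {A B Δ v x : ℝ} {N₁ N₂ M : ℕ} (hN₁ : 1 ≤ N₁) (hN₂M : N₂ ≤ M) (hA : (N₁ : ℝ) ≤ A)
    (hBdef : B = max (N₂ : ℝ) A) (hΔ : 0 < Δ) (hx : 1 ≤ x) (hv : 2 ≤ v) (hvx : Real.exp v ≤ x)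
    (hvM : Real.exp (v + 1) ≤ M) (hvA : Real.exp (v + 1) ≤ 2 * A) (hBM : B ≤ M) (hB3 : B ≤ 3 * x)
    {Q₁ : ℕ} (hQ₁ : 0 < Q₁) (a : ℤ) {f : ℤ → ℝ} (hf1 : ∀ k, |f k| ≤ 1) (hf : ∀ k : ℤ, f (k + q) = f k)
    {m : ℕ} (hm : 2 ≤ m) {δ Cδ : ℝ} (hδ : 0 < δ) (hC0 : 0 ≤ Cδ)
    (hCδ : ∀ n : ℕ, n ≠ 0 → (n.divisors.card : ℝ) ≤ Cδ * (n : ℝ) ^ δ) {L₀ : ℝ} (hL₀ : 0 < L₀) :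
    |∑ N ∈ (Icc N₁ N₂).filter (fun N : ℕ => (N : ℤ) ≡ a [ZMOD Q₁]),
        f (((N : ℤ) - a) / Q₁) * hypKD χ φ v N| ≤
      B₁ * (Cδ * (M : ℝ) ^ δ) *
          ((((Icc 1 M).filter (fun N : ℕ => (N : ℤ) ≡ a [ZMOD Q₁] ∧ (N₁ : ℝ) ≤ N ∧
              (N : ℝ) < A + Δ)).card : ℝ) +
            (((Icc 1 M).filter (fun N : ℕ => (N : ℤ) ≡ a [ZMOD Q₁] ∧ (N₂ : ℝ) - Δ ≤ N ∧
              (N : ℝ) < N₂ + 1)).card : ℝ)) +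
        q * ((((Int.gcd a Q₁ * q) ^ 2 : ℕ) : ℝ) * (Nat.divisors (Q₁ * q)).card / (Q₁ * q : ℕ) *
            (((Q₁ * q).divisors.card : ℝ) *
              (B₁ * (Cδ * B ^ δ) * (B / L₀ + 2) +
                (π ^ 2 / 3) / (2 * π) ^ m * (B - A) *
                  (logBumpNorm φ m * L₀ ^ m * Real.exp (-v) ^ m +
                    B₁ * plateauDerivConst m * (L₀ * Real.exp (v + 1) / Δ) ^ m))) +
          8 * (((Nat.divisors (Int.gcd a Q₁ * q)).card : ℝ) ^ 2 *
                ((Int.gcd a Q₁ * q : ℕ) * Real.sqrt (Int.gcd a Q₁ * q : ℕ)) *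
                (Nat.divisors (Q₁ * q)).card / (((Q₁ * q : ℕ) : ℝ) * Real.sqrt (Q₁ * q : ℕ))) *
            (200 * x * ((2 * B₂ + B₁) * plateauDerivConst 1 / Δ +
              B₁ * plateauDerivConst 2 * (3 * x) / Δ ^ 2)) *
            (((Q₁ * q : ℕ) : ℝ) ^ 2 / 4 * (Nat.divisors (Q₁ * q)).card ^ 2 *
              (1 + Real.log (Q₁ * q : ℕ)) ^ 2)) := by
  haveI : NeZero (Q₁ * q) := ⟨Nat.mul_ne_zero hQ₁.ne' (NeZero.ne q)⟩
  have hq : 0 < q := Nat.pos_of_ne_zero (NeZero.ne q)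
  have hB₁0 : 0 ≤ B₁ := (abs_nonneg _).trans (hB₁ 0)
  have hA0 : 0 ≤ A := le_trans (by positivity) hA
  have hAB : A ≤ B := by rw [hBdef]; exact le_max_right _ _
  set Q : ℕ := Q₁ * q with hQdef
  set g₀ : ℕ := Int.gcd a Q₁ with hg₀
  set q₀ : ℕ := g₀ * q with hq₀def
  set ψI : ℝ → ℝ := plateauProfile A B Δ with hψI
  set w : ℕ → ℝ := fun N => if (N : ℤ) ≡ a [ZMOD Q₁] then f (((N : ℤ) - a) / Q₁) else 0 with hw
  set K : ℕ → ℝ := fun N => hypKD χ φ v N with hK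
  -- `|w| ≤ 1_{N ≡ a}`
  have hwle : ∀ N : ℕ, |w N| ≤ if (N : ℤ) ≡ a [ZMOD Q₁] then 1 else 0 := by
    intro N; simp only [hw]; split_ifs
    · exact hf1 _
    · rw [abs_zero]
  -- `|K̃_v(N)| ≤ B₁ C_δ M^δ` on `1 ≤ N ≤ M`
  set Ksup : ℝ := B₁ * (Cδ * (M : ℝ) ^ δ) with hKsup
  have hKle : ∀ N ∈ Icc 1 M, |K N| ≤ Ksup := by
    intro N hN
    rw [mem_Icc] at hN
    have h1 := abs_hypKD_le χ hB₁ v N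
    refine h1.trans ?_
    rw [hKsup]
    refine mul_le_mul_of_nonneg_left ?_ hB₁0
    calc (N.divisors.card : ℝ) ≤ Cδ * (N : ℝ) ^ δ := hCδ N (by omega)
      _ ≤ Cδ * (M : ℝ) ^ δ := by
          gcongr
          exact_mod_cast hN.2
  have hKsup0 : 0 ≤ Ksup := by positivity
  -- (i) the sum over `Icc 1 M` with the sharp indicator
  have hstep1 : ∑ N ∈ (Icc N₁ N₂).filter (fun N : ℕ => (N : ℤ) ≡ a [ZMOD Q₁]),
      f (((N : ℤ) - a) / Q₁) * hypKD χ φ v N =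
      ∑ N ∈ Icc 1 M, w N * (if N₁ ≤ N ∧ N ≤ N₂ then (1 : ℝ) else 0) * K N := by
    rw [sum_filter]
    have hsub : Icc N₁ N₂ = (Icc 1 M).filter (fun N => N₁ ≤ N ∧ N ≤ N₂) := by
      ext N; simp only [mem_Icc, mem_filter]; omega
    rw [hsub, sum_filter]
    refine sum_congr rfl fun N _ => ?_
    simp only [hw, hK]
    split_ifs <;> ring
  -- (ii) the smoothed sum and the sub-progressions
  have hstep2 : ∑ N ∈ Icc 1 M, w N * ψI N * K N =
      ∑ j ∈ range q, f j * hypCongrSum χ φ A B Δ v M (Q₁ * q) (subProgression Q₁ q a j) := by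
    simp only [hw, hψI, hK]
    exact sum_hypKD_mul_eq_sum_hypCongrSum χ φ hΔ v hBM hq hf hQ₁ a
  -- (iii) the smoothing error
  have hstep3 : |∑ N ∈ Icc 1 M, w N * (if N₁ ≤ N ∧ N ≤ N₂ then (1 : ℝ) else 0) * K N -
      ∑ N ∈ Icc 1 M, w N * ψI N * K N| ≤
      Ksup * ((((Icc 1 M).filter (fun N : ℕ => (N : ℤ) ≡ a [ZMOD Q₁] ∧ (N₁ : ℝ) ≤ N ∧
              (N : ℝ) < A + Δ)).card : ℝ) +
            (((Icc 1 M).filter (fun N : ℕ => (N : ℤ) ≡ a [ZMOD Q₁] ∧ (N₂ : ℝ) - Δ ≤ N ∧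
              (N : ℝ) < N₂ + 1)).card : ℝ)) := by
    rw [← sum_sub_distrib]
    have hterm : ∀ N ∈ Icc 1 M, |w N * (if N₁ ≤ N ∧ N ≤ N₂ then (1 : ℝ) else 0) * K N - w N * ψI N * K N| ≤
        Ksup * ((if (N : ℤ) ≡ a [ZMOD Q₁] ∧ (N₁ : ℝ) ≤ N ∧ (N : ℝ) < A + Δ then (1 : ℝ) else 0) +
          (if (N : ℤ) ≡ a [ZMOD Q₁] ∧ (N₂ : ℝ) - Δ ≤ N ∧ (N : ℝ) < N₂ + 1 then (1 : ℝ) else 0)) := by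
      intro N hN
      have hfac : w N * (if N₁ ≤ N ∧ N ≤ N₂ then (1 : ℝ) else 0) * K N - w N * ψI N * K N =
          w N * ((if N₁ ≤ N ∧ N ≤ N₂ then (1 : ℝ) else 0) - ψI N) * K N := by ring
      rw [hfac, abs_mul, abs_mul]
      have hE := abs_indicator_sub_plateau_le (N₁ := N₁) (N₂ := N₂) hΔ hA hBdef N
      have hwN := hwle N
      have hKN := hKle N hN
      by_cases hP : (N : ℤ) ≡ a [ZMOD Q₁]
      · rw [if_pos hP] at hwN
        simp only [hP, true_and]
        calc |w N| * |(if N₁ ≤ N ∧ N ≤ N₂ then (1 : ℝ) else 0) - ψI N| * |K N|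
            ≤ 1 * ((if N₁ ≤ N ∧ (N : ℝ) < A + Δ then (1 : ℝ) else 0) +
                (if (N₂ : ℝ) - Δ < N ∧ N ≤ N₂ then (1 : ℝ) else 0)) * Ksup := by
              refine mul_le_mul (mul_le_mul hwN hE (abs_nonneg _) zero_le_one) hKN (abs_nonneg _) ?_
              positivity
          _ ≤ Ksup * ((if (N₁ : ℝ) ≤ N ∧ (N : ℝ) < A + Δ then (1 : ℝ) else 0) +
                (if (N₂ : ℝ) - Δ ≤ N ∧ (N : ℝ) < N₂ + 1 then (1 : ℝ) else 0)) := by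
              rw [one_mul, mul_comm]
              refine mul_le_mul_of_nonneg_left (add_le_add ?_ ?_) hKsup0
              · split_ifs with h1 h2
                · exact le_rfl
                · exact absurd ⟨by exact_mod_cast h1.1, h1.2⟩ h2
                · exact zero_le_one
                · exact le_rfl
              · split_ifs with h1 h2
                · exact le_rfl
                · exfalso; apply h2
                  exact ⟨h1.1.le, by have := h1.2; exact_mod_cast Nat.lt_succ_of_le this⟩
                · exact zero_le_one
                · exact le_rfl
      · rw [if_neg hP] at hwN
        have hw0 : w N = 0 := abs_eq_zero.mp (le_antisymm hwN (abs_nonneg _))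
        simp only [hP, false_and, if_false, add_zero, mul_zero]
        rw [hw0, abs_zero, zero_mul, zero_mul]
    refine (abs_sum_le_sum_abs _ _).trans ((sum_le_sum hterm).trans ?_)
    rw [← mul_sum, sum_add_distrib, ← sum_filter, ← sum_filter, sum_const, sum_const]
    simp only [mul_one, nsmul_eq_mul]
    exact le_rfl
  -- (iv) the bound for each `T(a_j)`
  have hg₀Q₁ : g₀ ∣ Q₁ := by
    have := Int.gcd_dvd_right a Q₁
    exact Int.natCast_dvd_natCast.mp this
  have hq₀Q : q₀ ∣ Q := Nat.mul_dvd_mul hg₀Q₁ dvd_rfl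
  have hqq₀ : q ∣ q₀ := Dvd.intro_left _ rfl
  have hqQ : q ∣ Q := Dvd.intro_left _ rfl
  have hQ0 : Q ≠ 0 := NeZero.ne Q
  have hTj : ∀ j ∈ range q, |hypCongrSum χ φ A B Δ v M (Q₁ * q) (subProgression Q₁ q a j)| ≤
      (((q₀ ^ 2 : ℕ) : ℝ) * (Nat.divisors Q).card / Q *
            (((Q.divisors.card : ℝ) *
              (B₁ * (Cδ * B ^ δ) * (B / L₀ + 2) +
                (π ^ 2 / 3) / (2 * π) ^ m * (B - A) *
                  (logBumpNorm φ m * L₀ ^ m * Real.exp (-v) ^ m +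
                    B₁ * plateauDerivConst m * (L₀ * Real.exp (v + 1) / Δ) ^ m)))) +
          8 * (((Nat.divisors q₀).card : ℝ) ^ 2 * ((q₀ : ℝ) * Real.sqrt q₀) *
                (Nat.divisors Q).card / ((Q : ℝ) * Real.sqrt Q)) *
            (200 * x * ((2 * B₂ + B₁) * plateauDerivConst 1 / Δ +
              B₁ * plateauDerivConst 2 * (3 * x) / Δ ^ 2)) *
            ((Q : ℝ) ^ 2 / 4 * (Nat.divisors Q).card ^ 2 * (1 + Real.log Q) ^ 2)) := by
    intro j _
    set a' := subProgression Q₁ q a j with ha'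
    have ha : Nat.gcd a'.val Q ∣ q₀ := by
      rw [hq₀def, hg₀, hQdef]
      exact gcd_val_subProgression_dvd hQ₁ hq a j
    have h := abs_hypCongrSum_le χ hφ hB₁ hA0 hΔ hAB hv hvM hvA hBM hqQ hq₀Q hqq₀ ha hm hδ hC0 hCδ hL₀
    refine h.trans ?_
    -- `q₀' ≤ q₀²` and `M_Δ ≤ 200 x P`
    have hq₀' : (Nat.gcd (q₀ * a'.val) Q : ℝ) ≤ ((q₀ ^ 2 : ℕ) : ℝ) := by
      have hq₀pos : 0 < q₀ := Nat.mul_pos (Nat.pos_of_ne_zero fun h0 => hQ0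
        (Nat.eq_zero_of_zero_dvd (by rw [hq₀def, h0, zero_mul] at hq₀Q; exact hq₀Q))) hq
      set d := Nat.gcd (q₀ * a'.val) Q with hd
      have h1 : d ∣ Nat.gcd d q₀ * Nat.gcd d a'.val :=
        Nat.dvd_gcd_mul_gcd_iff_dvd_mul.mpr (Nat.gcd_dvd_left _ _)
      have h2 : Nat.gcd d q₀ ≤ q₀ := Nat.gcd_le_right _ hq₀pos
      have h3 : Nat.gcd d a'.val ∣ q₀ :=
        (Nat.dvd_gcd (Nat.gcd_dvd_right _ _) ((Nat.gcd_dvd_left _ _).trans (Nat.gcd_dvd_right _ _))).trans ha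
      have h4 : Nat.gcd d a'.val ≤ q₀ := Nat.le_of_dvd hq₀pos h3
      have hdpos : 0 < d := Nat.gcd_pos_of_pos_right _ (Nat.pos_of_ne_zero hQ0)
      have h5 : d ≤ Nat.gcd d q₀ * Nat.gcd d a'.val :=
        Nat.le_of_dvd (Nat.mul_pos (Nat.gcd_pos_of_pos_left _ hdpos)
          (Nat.gcd_pos_of_pos_left _ hdpos)) h1
      have : d ≤ q₀ ^ 2 := by rw [sq]; exact h5.trans (Nat.mul_le_mul h2 h4)
      exact_mod_cast this
    have hMΔ := sum_norm_mixedDiff_hypWeightC_le hφ hB₁ hB₂ (A := A) (B := B) hΔ hx hv hvx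
      (hA0.trans hAB) hB3 M M
    have hI0 : 0 ≤ logBumpNorm φ m := integral_nonneg fun y => norm_nonneg _
    have hKm := plateauDerivConst_nonneg m
    have hK1 := plateauDerivConst_nonneg 1
    have hK2 := plateauDerivConst_nonneg 2
    have hB₂0 : 0 ≤ B₂ := (abs_nonneg _).trans (hB₂ 0)
    have hBA : 0 ≤ B - A := by linarith
    have hB0 : 0 ≤ B := hA0.trans hAB
    have hQr : (0 : ℝ) < Q := by exact_mod_cast Nat.pos_of_ne_zero hQ0
    have hXf0 : 0 ≤ (Q.divisors.card : ℝ) *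
        (B₁ * (Cδ * B ^ δ) * (B / L₀ + 2) +
          (π ^ 2 / 3) / (2 * π) ^ m * (B - A) *
            (logBumpNorm φ m * L₀ ^ m * Real.exp (-v) ^ m +
              B₁ * plateauDerivConst m * (L₀ * Real.exp (v + 1) / Δ) ^ m)) := by positivity
    have hS0 : 0 ≤ (Q : ℝ) ^ 2 / 4 * (Nat.divisors Q).card ^ 2 * (1 + Real.log Q) ^ 2 := by positivity
    refine add_le_add ?_ ?_
    · refine mul_le_mul_of_nonneg_right ?_ hXf0
      refine div_le_div_of_nonneg_right ?_ hQr.le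
      exact mul_le_mul_of_nonneg_right hq₀' (by positivity)
    · refine mul_le_mul_of_nonneg_right ?_ hS0
      refine mul_le_mul_of_nonneg_left hMΔ ?_
      positivity
  -- combine
  have hmain := abs_sum_mul_le_card_mul hf1 hTj
  rw [← hstep2] at hmain
  rw [hstep1]
  have htri : ∀ S T : ℝ, |S| ≤ |S - T| + |T| := fun S T => by
    have := abs_add_le (S - T) T; rwa [sub_add_cancel] at this
  refine (htri _ (∑ N ∈ Icc 1 M, w N * ψI N * K N)).trans ?_
  exact add_le_add hstep3 hmain

/-! ### Elementary growth lemmas -/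

/-- Eventually `log x ≤ x^η` (`η > 0`). [folklore] -/
theorem exists_log_le_rpow {η : ℝ} (hη : 0 < η) : ∃ x₁ : ℝ, 1 ≤ x₁ ∧ ∀ x : ℝ, x₁ ≤ x → Real.log x ≤ x ^ η := by
  have h := (isLittleO_log_rpow_atTop hη).bound (c := 1) one_pos
  rw [Filter.eventually_atTop] at h
  obtain ⟨x₁, hx₁⟩ := h
  refine ⟨max x₁ 1, le_max_right _ _, fun x hx => ?_⟩
  have h1 := hx₁ x (le_trans (le_max_left _ _) hx)
  rw [one_mul, Real.norm_eq_abs, Real.norm_eq_abs] at h1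
  have hx0 : 0 ≤ x := le_trans (le_trans zero_le_one (le_max_right _ _)) hx
  calc Real.log x ≤ |Real.log x| := le_abs_self _
    _ ≤ |x ^ η| := h1
    _ = x ^ η := abs_of_nonneg (Real.rpow_nonneg hx0 η)

/-! ### Proposition 7.1 (i) -/

set_option maxHeartbeats 1600000 in
/-- **Proposition 7.1 (i)** (`k = 2`): for `0 < ε₀ ≤ 1/100` there are `c > 0`, `C`, `x₀` such that for
`x ≥ x₀`, `q_χ ≤ x^{1/20}`, any character `χ (mod q_χ)`, moduli `1 ≤ Q₁ ≤ x^{51/100}`, residues `a`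
with `((a, Q₁) + 1)² ≤ x`, `1`-bounded `q_χ`-periodic `f : ℤ → ℝ`, and `[N₁, N₂] ⊆ [1, 2x]`,
`|∑_{N₁ ≤ N ≤ N₂, N ≡ a (Q₁)} (χ∗log)♭(N) f((N-a)/Q₁)| ≤ C ((a,Q₁)+1)² x^{1-c}/Q₁`, where `(χ∗log)♭` is taken with
`X = log x`, `U₀ = log(D q_χ²)`, `D = x^{ε₀/20}`. (The source's bound is
`(x/q)((a,q)^{3/2} q_χ^{9/2} q^{3/2}/x^{1-ε₀} + x^ε (a,q)²/D^{1/2} + x^{-ε})` for `q ≤ x^{1/2+1/100}`; in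
the stated range every term is `≪ x^{1-c}/q`.) [cite: TaoTeravainen2021, Proposition 7.1 (i)] -/
theorem prop71_i {φ ψ : ℝ → ℝ} (hφ : IsBump φ) (hψ : IsSmoothCutoff ψ) {ε₀ : ℝ} (hε₀ : 0 < ε₀)
    (hε₀1 : ε₀ ≤ 1 / 100) :
    ∃ c : ℝ, 0 < c ∧ ∃ C : ℝ, 0 ≤ C ∧ ∃ x₀ : ℝ, 1 ≤ x₀ ∧ ∀ x : ℝ, x₀ ≤ x →
      ∀ (q : ℕ) [NeZero q] (χ : DirichletCharacter ℂ q), (q : ℝ) ≤ x ^ (1 / 20 : ℝ) →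
      ∀ (Q₁ : ℕ), 0 < Q₁ → (Q₁ : ℝ) ≤ x ^ (51 / 100 : ℝ) →
      ∀ (a : ℤ), (((Int.gcd a Q₁ : ℕ) : ℝ) + 1) ^ 2 ≤ x →
      ∀ (f : ℤ → ℝ), (∀ k, |f k| ≤ 1) → (∀ k : ℤ, f (k + q) = f k) →
      ∀ (N₁ N₂ : ℕ), 1 ≤ N₁ → (N₂ : ℝ) ≤ 2 * x →
        |∑ N ∈ (Icc N₁ N₂).filter (fun N : ℕ => (N : ℤ) ≡ a [ZMOD Q₁]),
            flatLog χ φ ψ (Real.log x) (ε₀ / 20 * Real.log x + 2 * Real.log q) N *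
              f (((N : ℤ) - a) / Q₁)| ≤
          C * (((Int.gcd a Q₁ : ℕ) : ℝ) + 1) ^ 2 * x ^ (1 - c) / Q₁ := by
  -- constants
  obtain ⟨B₁, hB₁0, hB₁⟩ := hφ.exists_bound_deriv
  obtain ⟨B₂, hB₂0, hB₂⟩ := hφ.exists_bound_deriv2
  obtain ⟨Bψ, hBψ0, hBψ⟩ := hψ.exists_abs_le
  set ε : ℝ := ε₀ / 500 with hεdef
  have hε : 0 < ε := by positivity
  have hεsmall : ε ≤ 1 / 50000 := by rw [hεdef]; linarith
  set δ : ℝ := ε / 2 with hδdef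
  have hδ : 0 < δ := by positivity
  obtain ⟨Cδ, hCδ1, hCδ⟩ := exists_card_divisors_le_mul_rpow hδ
  have hC0 : 0 ≤ Cδ := by linarith
  set m : ℕ := ⌈200 / ε₀⌉₊ + 2 with hmdef
  have hm : 2 ≤ m := by omega
  have hmε : 5 ≤ (m : ℝ) * ε₀ / 40 := by
    have : 200 / ε₀ ≤ (⌈200 / ε₀⌉₊ : ℝ) := Nat.le_ceil _
    have hm' : (m : ℝ) = (⌈200 / ε₀⌉₊ : ℝ) + 2 := by rw [hmdef]; push_cast; ring
    rw [hm']
    have h1 : 200 / ε₀ * ε₀ = 200 := div_mul_cancel₀ _ hε₀.ne'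
    nlinarith
  set η : ℝ := ε / 12 with hηdef
  have hη : 0 < η := by positivity
  obtain ⟨x₁, hx₁1, hx₁⟩ := exists_log_le_rpow hη
  set Km : ℝ := plateauDerivConst m
  set K₁ : ℝ := plateauDerivConst 1
  set K₂ : ℝ := plateauDerivConst 2
  set Im : ℝ := logBumpNorm φ m
  have hKm := plateauDerivConst_nonneg m
  have hK1 := plateauDerivConst_nonneg 1
  have hK2 := plateauDerivConst_nonneg 2
  have hIm : 0 ≤ Im := integral_nonneg fun y => norm_nonneg _
  set C₁ : ℝ := (π ^ 2 / 3) / (2 * π) ^ m with hC₁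
  have hC₁0 : 0 ≤ C₁ := by positivity
  set CP : ℝ := (2 * B₂ + B₁) * K₁ + 3 * B₁ * K₂ with hCP
  have hCP0 : 0 ≤ CP := by positivity
  set Csum : ℝ := 18 * B₁ * Cδ + 8 * B₁ * Cδ ^ 3 +
    2 * C₁ * Cδ ^ 2 * (Im + B₁ * Km * Real.exp 1 ^ m) + 400 * Cδ ^ 5 * CP * 4 with hCsum
  have hCsum0 : 0 ≤ Csum := by positivity
  -- the thresholds
  set x₂ : ℝ := Real.exp (40 / ε₀) with hx₂
  set x₃ : ℝ := (Real.exp 1) ^ (1 / (24 * ε)) with hx₃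
  refine ⟨ε / 4, by positivity, (1 + Bψ) * Csum, by positivity,
    max (max x₁ x₂) (max x₃ 4), le_trans (by norm_num) (le_trans (le_max_right x₃ 4) (le_max_right _ _)), ?_⟩
  intro x hx q _ χ hq Q₁ hQ₁ hQ₁x a haH f hf1 hf N₁ N₂ hN₁ hN₂
  -- the gcd parameter
  set H : ℝ := ((Int.gcd a Q₁ : ℕ) : ℝ) + 1 with hHdef
  have hH1 : 1 ≤ H := by rw [hHdef]; linarith only [(Nat.cast_nonneg (Int.gcd a Q₁) : (0 : ℝ) ≤ _)]
  have hxH : H ^ 2 ≤ x := haH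
  set CsumH : ℝ := 18 * B₁ * Cδ + 8 * B₁ * Cδ ^ 3 * H ^ 2 +
    2 * C₁ * Cδ ^ 2 * H ^ 2 * (Im + B₁ * Km * Real.exp 1 ^ m) +
    400 * Cδ ^ 5 * H ^ 2 * CP * 4 with hCsumHdef
  have hCsumH : CsumH ≤ Csum * H ^ 2 := by
    rw [hCsumHdef, hCsum]
    have hH2 : 1 ≤ H ^ 2 := one_le_pow₀ hH1
    have : 18 * B₁ * Cδ ≤ 18 * B₁ * Cδ * H ^ 2 := le_mul_of_one_le_right (by positivity) hH2
    nlinarith only [this]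
  -- unpack the thresholds
  have hxx₁ : x₁ ≤ x := le_trans (le_trans (le_max_left _ _) (le_max_left _ _)) hx
  have hxx₂ : x₂ ≤ x := le_trans (le_trans (le_max_right _ _) (le_max_left _ _)) hx
  have hxx₃ : x₃ ≤ x := le_trans (le_trans (le_max_left _ _) (le_max_right _ _)) hx
  have hx4 : 4 ≤ x := le_trans (le_trans (le_max_right _ _) (le_max_right _ _)) hx
  have hx1 : 1 ≤ x := by linarith only [hx4]
  have hx0 : 0 < x := by linarith only [hx4]
  have hlogx0 : 0 ≤ Real.log x := Real.log_nonneg hx1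
  have hmono : ∀ a b : ℝ, a ≤ b → x ^ a ≤ x ^ b := fun a b h => Real.rpow_le_rpow_of_exponent_le hx1 h
  have hxadd : ∀ a b : ℝ, x ^ a * x ^ b = x ^ (a + b) := fun a b => (Real.rpow_add hx0 a b).symm
  have hx_one : x ^ (1 : ℝ) = x := Real.rpow_one x
  have hxge1 : ∀ a : ℝ, 0 ≤ a → 1 ≤ x ^ a := fun a ha => Real.one_le_rpow hx1 ha
  have hxle1 : ∀ a : ℝ, a ≤ 0 → x ^ a ≤ 1 := fun a ha => Real.rpow_le_one_of_one_le_of_nonpos hx1 ha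
  have hxpos : ∀ a : ℝ, 0 < x ^ a := fun a => Real.rpow_pos_of_pos hx0 a
  have hxmul1 : ∀ a : ℝ, x ^ a * x = x ^ (a + 1) := fun a => by
    rw [show x ^ a * x = x ^ a * x ^ (1 : ℝ) by rw [hx_one], hxadd]
  have hx1mul : ∀ a : ℝ, x * x ^ a = x ^ (1 + a) := fun a => by
    rw [show x * x ^ a = x ^ (1 : ℝ) * x ^ a by rw [hx_one], hxadd]
  -- `log x ≤ x^η`, `log x ≥ 40/ε₀`, `e ≤ 2 x^{ε₀/20 - ε}` -- hmm: `x₃^{24ε} = e`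
  have hlogle : Real.log x ≤ x ^ η := hx₁ x hxx₁
  have hlog40 : 40 / ε₀ ≤ Real.log x := by
    rw [← Real.log_exp (40 / ε₀)]; exact Real.log_le_log (Real.exp_pos _) hxx₂
  have hq1 : (1 : ℝ) ≤ q := by exact_mod_cast Nat.pos_of_ne_zero (NeZero.ne q)
  have hq0 : (0 : ℝ) < q := by linarith
  have hlogq : Real.log q ≤ 1 / 20 * Real.log x := by
    calc Real.log q ≤ Real.log (x ^ (1 / 20 : ℝ)) := Real.log_le_log hq0 hq
      _ = 1 / 20 * Real.log x := Real.log_rpow hx0 _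
  have hlogq0 : 0 ≤ Real.log q := Real.log_nonneg hq1
  -- the parameters
  set X : ℝ := Real.log x with hXdef
  set U₀ : ℝ := ε₀ / 20 * Real.log x + 2 * Real.log q with hU₀def
  have hU₀2 : 2 ≤ U₀ := by
    rw [hU₀def]
    have : 2 ≤ ε₀ / 20 * Real.log x := by
      have h := mul_le_mul_of_nonneg_left hlog40 (by positivity : 0 ≤ ε₀ / 20)
      rw [show ε₀ / 20 * (40 / ε₀) = 2 by field_simp; ring] at h
      exact h
    linarith only [this, hlogq0]
  have hU₀pos : 0 < U₀ := by linarith only [hU₀2]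
  have h2U₀ : 2 * U₀ ≤ X := by
    rw [hU₀def, hXdef]
    have h1 : (ε₀ / 10 + 1 / 5) * Real.log x ≤ Real.log x :=
      mul_le_of_le_one_left hlogx0 (by linarith only [hε₀1])
    have h2 : 2 * (ε₀ / 20 * Real.log x + 2 * Real.log q) ≤ (ε₀ / 10 + 1 / 5) * Real.log x := by
      have h3 : 2 * (ε₀ / 20 * Real.log x + 2 * Real.log q) =
          (ε₀ / 10) * Real.log x + 4 * Real.log q := by ring
      have h4 : (ε₀ / 10 + 1 / 5) * Real.log x = (ε₀ / 10) * Real.log x + 4 * (1 / 20 * Real.log x) := by ring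
      rw [h3, h4]
      linarith only [hlogq]
    exact h2.trans h1
  set Δ : ℝ := x ^ (1 - 2 * ε) with hΔdef
  have hΔ : 0 < Δ := hxpos _
  have hΔ1 : 1 ≤ Δ := hxge1 _ (by linarith only [hεsmall])
  have hΔx : Δ ≤ x := by
    calc Δ ≤ x ^ (1 : ℝ) := hmono _ _ (by linarith only [hε])
      _ = x := hx_one
  set A : ℝ := max (N₁ : ℝ) (x ^ (1 - ε)) with hAdef
  set B : ℝ := max (N₂ : ℝ) A with hBdef
  set M : ℕ := ⌊3 * x⌋₊ with hMdef
  have hM3 : (M : ℝ) ≤ 3 * x := Nat.floor_le (by linarith)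
  have hM3' : 3 * x - 1 ≤ (M : ℝ) := by
    have := Nat.lt_floor_add_one (3 * x); rw [hMdef]; linarith
  set L₀ : ℝ := x ^ (ε₀ / 40 - 4 * ε) * (q : ℝ) ^ 2 with hL₀def
  have hL₀ : 0 < L₀ := by positivity
  -- WLOG `N₁ ≤ N₂`
  rcases lt_or_ge N₂ N₁ with hN | hN
  · have : (Icc N₁ N₂).filter (fun N : ℕ => (N : ℤ) ≡ a [ZMOD Q₁]) = ∅ := by
      rw [Finset.Icc_eq_empty (by omega), Finset.filter_empty]
    rw [this, sum_empty, abs_zero]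
    positivity
  have hN₁x : (N₁ : ℝ) ≤ 2 * x := le_trans (by exact_mod_cast hN) hN₂
  have hxε : x ^ (1 - ε) ≤ x := by
    calc x ^ (1 - ε) ≤ x ^ (1 : ℝ) := hmono _ _ (by linarith only [hε])
      _ = x := hx_one
  have hA2x : A ≤ 2 * x := by
    rw [hAdef, max_le_iff]; exact ⟨hN₁x, by linarith only [hxε, hx1]⟩
  have hA0 : 0 ≤ A := le_trans (by positivity) (le_max_left _ _)
  have hAN₁ : (N₁ : ℝ) ≤ A := le_max_left _ _
  have hB2x : B ≤ 2 * x := by rw [hBdef, max_le_iff]; exact ⟨hN₂, hA2x⟩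
  have hAB : A ≤ B := le_max_right _ _
  have hB0 : 0 ≤ B := hA0.trans hAB
  have hBM : B ≤ M := by linarith only [hB2x, hM3', hx1]
  have hB3 : B ≤ 3 * x := by linarith only [hB2x, hx1]
  have hN₂M : N₂ ≤ M := by
    rw [hMdef]; exact Nat.le_floor (by linarith only [hN₂, hx1])
  -- the weights
  set w : ℕ → ℝ := fun N => if (N : ℤ) ≡ a [ZMOD Q₁] then f (((N : ℤ) - a) / Q₁) else 0 with hw
  have hsumw : ∑ N ∈ (Icc N₁ N₂).filter (fun N : ℕ => (N : ℤ) ≡ a [ZMOD Q₁]),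
      flatLog χ φ ψ (Real.log x) (ε₀ / 20 * Real.log x + 2 * Real.log q) N * f (((N : ℤ) - a) / Q₁) =
      ∑ N ∈ Icc N₁ N₂, w N * flatLog χ φ ψ X U₀ N := by
    rw [sum_filter]
    refine sum_congr rfl fun N _ => ?_
    simp only [hw]
    split_ifs <;> ring
  rw [hsumw]
  -- the bound for one `t = e^v`
  have hSv : ∀ v ∈ Set.Icc U₀ (X - U₀),
      |∑ N ∈ Icc N₁ N₂, w N * hypKD χ φ v N| ≤ CsumH * x ^ (1 - ε / 2) / Q₁ := by
    intro v hv
    have hv2 : 2 ≤ v := le_trans hU₀2 hv.1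
    have hvX : v ≤ X - U₀ := hv.2
    have hvx : Real.exp v ≤ x := by
      calc Real.exp v ≤ Real.exp X := Real.exp_le_exp.mpr (by linarith only [hvX, hU₀pos])
        _ = x := by rw [hXdef, Real.exp_log hx0]
    -- `e^{v+1} ≤ e x^{1 - ε₀/20}`
    have hexpU₀ : Real.exp (-U₀) ≤ x ^ (-(ε₀ / 20)) := by
      rw [hU₀def, show -(ε₀ / 20 * Real.log x + 2 * Real.log q) =
        Real.log x * (-(ε₀ / 20)) + -(2 * Real.log q) by ring, Real.exp_add, ← Real.rpow_def_of_pos hx0]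
      have : Real.exp (-(2 * Real.log q)) ≤ 1 := by
        rw [Real.exp_le_one_iff]; linarith only [hlogq0]
      calc x ^ (-(ε₀ / 20)) * Real.exp (-(2 * Real.log q)) ≤ x ^ (-(ε₀ / 20)) * 1 :=
            mul_le_mul_of_nonneg_left this (hxpos _).le
        _ = x ^ (-(ε₀ / 20)) := mul_one _
    have hexpv : Real.exp (-v) ≤ x ^ (-(ε₀ / 20)) :=
      le_trans (Real.exp_le_exp.mpr (by linarith only [hv.1])) hexpU₀
    have hexpv1 : Real.exp (v + 1) ≤ Real.exp 1 * x ^ (1 - ε₀ / 20) := by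
      have h1 : Real.exp (v + 1) ≤ Real.exp (X - U₀ + 1) := Real.exp_le_exp.mpr (by linarith only [hvX])
      refine h1.trans ?_
      rw [show X - U₀ + 1 = 1 + X + -U₀ by ring, Real.exp_add, Real.exp_add, hXdef, Real.exp_log hx0]
      rw [show (1 : ℝ) - ε₀ / 20 = 1 + -(ε₀ / 20) by ring, ← hxadd, hx_one, mul_assoc]
      exact mul_le_mul_of_nonneg_left (mul_le_mul_of_nonneg_left hexpU₀ hx0.le) (Real.exp_pos _).le
    have he3 : Real.exp 1 ≤ 3 := by have := Real.exp_one_lt_d9; linarith only [this]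
    have hx1ε₀ : x ^ (1 - ε₀ / 20) ≤ x := by
      calc x ^ (1 - ε₀ / 20) ≤ x ^ (1 : ℝ) := hmono _ _ (by linarith only [hε₀])
        _ = x := hx_one
    have hvM : Real.exp (v + 1) ≤ M := by
      -- `e x^{1-ε₀/20} ≤ e x e^{-2}`? simpler: `exp(v+1) ≤ exp(X - U₀ + 1) ≤ exp(X - 1) = x/e ≤ 3x - 1`
      have h1 : Real.exp (v + 1) ≤ Real.exp (X - 1) := Real.exp_le_exp.mpr (by linarith only [hvX, hU₀2])
      refine h1.trans ?_
      rw [Real.exp_sub, hXdef, Real.exp_log hx0]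
      have he1 : 1 ≤ Real.exp 1 := by have := Real.exp_one_gt_d9; linarith only [this]
      have : x / Real.exp 1 ≤ x := div_le_self hx0.le he1
      linarith only [this, hM3', hx1]
    -- `e^{v+1} ≤ 2A` from `e ≤ 2 x^{ε₀/20 - ε}` (threshold `x₃`)
    have hx₃pow : Real.exp 1 ≤ x ^ (ε₀ / 20 - ε) := by
      have h24 : ε₀ / 20 - ε = 24 * ε := by rw [hεdef]; ring
      rw [h24]
      have hpos : 0 < 1 / (24 * ε) := by positivity
      have h1 : x₃ ^ (24 * ε) ≤ x ^ (24 * ε) :=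
        Real.rpow_le_rpow (by positivity) hxx₃ (by positivity)
      have h2 : x₃ ^ (24 * ε) = Real.exp 1 := by
        rw [hx₃, ← Real.rpow_mul (Real.exp_pos 1).le, show 1 / (24 * ε) * (24 * ε) = 1 by field_simp,
          Real.rpow_one]
      rw [h2] at h1; exact h1
    have hvA : Real.exp (v + 1) ≤ 2 * A := by
      refine hexpv1.trans ?_
      have hA' : x ^ (1 - ε) ≤ A := le_max_right _ _
      calc Real.exp 1 * x ^ (1 - ε₀ / 20) ≤ x ^ (ε₀ / 20 - ε) * x ^ (1 - ε₀ / 20) :=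
            mul_le_mul_of_nonneg_right hx₃pow (hxpos _).le
        _ = x ^ (1 - ε) := by rw [hxadd]; ring_nf
        _ ≤ 2 * A := by linarith only [hA', (hxpos (1 - ε)).le]
    -- apply the one-`t` bound
    have hfil : ∑ N ∈ Icc N₁ N₂, w N * hypKD χ φ v N =
        ∑ N ∈ (Icc N₁ N₂).filter (fun N : ℕ => (N : ℤ) ≡ a [ZMOD Q₁]),
          f (((N : ℤ) - a) / Q₁) * hypKD χ φ v N := by
      rw [sum_filter]
      refine sum_congr rfl fun N _ => ?_
      simp only [hw]
      split_ifs <;> ring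
    rw [hfil]
    refine (abs_hypKD_progression_sum_le χ hφ hB₁ hB₂ (A := A) (B := B) (Δ := Δ) (x := x)
      hN₁ hN₂M hAN₁ rfl hΔ hx1 hv2 hvx hvM hvA hBM hB3 hQ₁ a hf1 hf hm hδ hC0
      (fun n hn => hCδ n hn) hL₀).trans ?_
    -- notation for the pieces
    have hQ₁r : (0 : ℝ) < Q₁ := by exact_mod_cast hQ₁
    have hQ₁1 : (1 : ℝ) ≤ Q₁ := by exact_mod_cast hQ₁
    obtain ⟨Q, hQdef⟩ : ∃ Q : ℕ, Q = Q₁ * q := ⟨_, rfl⟩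
    obtain ⟨g₀, hg₀⟩ : ∃ g₀ : ℕ, g₀ = Int.gcd a Q₁ := ⟨_, rfl⟩
    obtain ⟨q₀, hq₀def⟩ : ∃ q₀ : ℕ, q₀ = g₀ * q := ⟨_, rfl⟩
    rw [← hg₀, ← hq₀def, ← hQdef]
    have hQr : (Q : ℝ) = Q₁ * q := by rw [hQdef]; push_cast; ring
    have hQpos : (0 : ℝ) < Q := by rw [hQr]; positivity
    have hQ1 : (1 : ℝ) ≤ Q := by rw [hQr]; exact one_le_mul_of_one_le_of_one_le hQ₁1 hq1
    have hg₀H : (g₀ : ℝ) ≤ H := by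
      rw [hHdef, hg₀]; linarith only [(Nat.cast_nonneg (Int.gcd a Q₁) : (0 : ℝ) ≤ _)]
    have hg₀1 : (1 : ℝ) ≤ g₀ := by
      have : 0 < g₀ := by
        rw [hg₀]; exact Int.gcd_pos_of_ne_zero_right _ (by exact_mod_cast hQ₁.ne')
      exact_mod_cast this
    have hq₀r : (q₀ : ℝ) = g₀ * q := by rw [hq₀def]; push_cast; ring
    have hq₀pos : (0 : ℝ) < q₀ := by rw [hq₀r]; positivity
    have hq₀1 : (1 : ℝ) ≤ q₀ := by rw [hq₀r]; exact one_le_mul_of_one_le_of_one_le hg₀1 hq1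
    have hq₀H : (q₀ : ℝ) ≤ H * q := by rw [hq₀r]; exact mul_le_mul_of_nonneg_right hg₀H hq0.le
    -- powers of `x`
    have hq20 : (q : ℝ) ≤ x ^ (1 / 20 : ℝ) := hq
    have hQx : (Q : ℝ) ≤ x := by
      rw [hQr]
      calc (Q₁ : ℝ) * q ≤ x ^ (51 / 100 : ℝ) * x ^ (1 / 20 : ℝ) :=
            mul_le_mul hQ₁x hq20 hq0.le (hxpos _).le
        _ = x ^ (51 / 100 + 1 / 20 : ℝ) := hxadd _ _
        _ ≤ x ^ (1 : ℝ) := hmono _ _ (by norm_num)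
        _ = x := hx_one
    have hHx : H ≤ x ^ (1 / 2 : ℝ) := by
      have h1 : H = (H ^ 2) ^ (1 / 2 : ℝ) := by
        rw [← Real.sqrt_eq_rpow, Real.sqrt_sq (by linarith only [hH1])]
      rw [h1]
      exact Real.rpow_le_rpow (by positivity) hxH (by norm_num)
    have hq₀x : (q₀ : ℝ) ≤ x := by
      calc (q₀ : ℝ) ≤ H * q := hq₀H
        _ ≤ x ^ (1 / 2 : ℝ) * x ^ (1 / 20 : ℝ) := mul_le_mul hHx hq20 hq0.le (hxpos _).le
        _ = x ^ (1 / 2 + 1 / 20 : ℝ) := hxadd _ _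
        _ ≤ x ^ (1 : ℝ) := hmono _ _ (by norm_num)
        _ = x := hx_one
    -- divisor bounds
    have hτ : ∀ n : ℕ, 1 ≤ (n : ℝ) → (n : ℝ) ≤ x → (n.divisors.card : ℝ) ≤ Cδ * x ^ δ := by
      intro n hn1 hnx
      have hn0 : n ≠ 0 := by rintro rfl; norm_num at hn1
      calc (n.divisors.card : ℝ) ≤ Cδ * (n : ℝ) ^ δ := hCδ n hn0
        _ ≤ Cδ * x ^ δ := by gcongr
    have hτQ : ((Q.divisors.card : ℕ) : ℝ) ≤ Cδ * x ^ δ := hτ Q hQ1 hQx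
    have hτq₀ : ((q₀.divisors.card : ℕ) : ℝ) ≤ Cδ * x ^ δ := hτ q₀ hq₀1 hq₀x
    have hδ1 : δ ≤ 1 := by rw [hδdef]; linarith only [hεsmall]
    have hMδ : (M : ℝ) ^ δ ≤ 3 * x ^ δ := by
      calc (M : ℝ) ^ δ ≤ (3 * x) ^ δ := Real.rpow_le_rpow (by positivity) hM3 hδ.le
        _ = 3 ^ δ * x ^ δ := Real.mul_rpow (by norm_num) hx0.le
        _ ≤ 3 * x ^ δ := by
            gcongr
            calc (3 : ℝ) ^ δ ≤ 3 ^ (1 : ℝ) := Real.rpow_le_rpow_of_exponent_le (by norm_num) hδ1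
              _ = 3 := Real.rpow_one 3
    have hBδ : B ^ δ ≤ 2 * x ^ δ := by
      calc B ^ δ ≤ (2 * x) ^ δ := Real.rpow_le_rpow hB0 hB2x hδ.le
        _ = 2 ^ δ * x ^ δ := Real.mul_rpow (by norm_num) hx0.le
        _ ≤ 2 * x ^ δ := by
            gcongr
            calc (2 : ℝ) ^ δ ≤ 2 ^ (1 : ℝ) := Real.rpow_le_rpow_of_exponent_le (by norm_num) hδ1
              _ = 2 := Real.rpow_one 2
    -- (T1) the smoothing error
    have hxQ₁ : (Q₁ : ℝ) ≤ x ^ (1 - ε) := hQ₁x.trans (hmono _ _ (by linarith only [hεsmall]))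
    have hΔε : Δ ≤ x ^ (1 - ε) := hmono _ _ (by linarith only [hε])
    have hcard₁ : (((Icc 1 M).filter (fun N : ℕ => (N : ℤ) ≡ a [ZMOD Q₁] ∧ (N₁ : ℝ) ≤ N ∧
        (N : ℝ) < A + Δ)).card : ℝ) ≤ 2 * x ^ (1 - ε) / Q₁ + 1 := by
      have h := card_filter_class_Ico_le hQ₁ a (lo := (N₁ : ℝ)) (hi := A + Δ)
        (by linarith only [hAN₁, hΔ]) (Icc 1 M)
      refine h.trans ?_
      have hA' : A ≤ N₁ + x ^ (1 - ε) := by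
        rw [hAdef, max_le_iff]
        exact ⟨by linarith only [(hxpos (1 - ε)).le], by linarith only [(Nat.cast_nonneg N₁ : (0:ℝ) ≤ N₁)]⟩
      have : (A + Δ - N₁) / Q₁ ≤ 2 * x ^ (1 - ε) / Q₁ :=
        div_le_div_of_nonneg_right (by linarith only [hA', hΔε]) hQ₁r.le
      linarith only [this]
    have hcard₂ : (((Icc 1 M).filter (fun N : ℕ => (N : ℤ) ≡ a [ZMOD Q₁] ∧ (N₂ : ℝ) - Δ ≤ N ∧
        (N : ℝ) < N₂ + 1)).card : ℝ) ≤ 2 * x ^ (1 - ε) / Q₁ + 1 := by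
      have h := card_filter_class_Ico_le hQ₁ a (lo := (N₂ : ℝ) - Δ) (hi := (N₂ : ℝ) + 1)
        (by linarith only [hΔ]) (Icc 1 M)
      refine h.trans ?_
      have : ((N₂ : ℝ) + 1 - ((N₂ : ℝ) - Δ)) / Q₁ ≤ 2 * x ^ (1 - ε) / Q₁ :=
        div_le_div_of_nonneg_right (by linarith only [hΔε, hΔ1]) hQ₁r.le
      linarith only [this]
    have hone : (1 : ℝ) ≤ x ^ (1 - ε) / Q₁ := by rw [le_div_iff₀ hQ₁r, one_mul]; exact hxQ₁
    have hT1 : B₁ * (Cδ * (M : ℝ) ^ δ) *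
        ((((Icc 1 M).filter (fun N : ℕ => (N : ℤ) ≡ a [ZMOD Q₁] ∧ (N₁ : ℝ) ≤ N ∧
            (N : ℝ) < A + Δ)).card : ℝ) +
          (((Icc 1 M).filter (fun N : ℕ => (N : ℤ) ≡ a [ZMOD Q₁] ∧ (N₂ : ℝ) - Δ ≤ N ∧
            (N : ℝ) < N₂ + 1)).card : ℝ)) ≤ 18 * B₁ * Cδ * (x ^ (1 - ε / 2) / Q₁) := by
      have hcards : (((Icc 1 M).filter (fun N : ℕ => (N : ℤ) ≡ a [ZMOD Q₁] ∧ (N₁ : ℝ) ≤ N ∧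
            (N : ℝ) < A + Δ)).card : ℝ) +
          (((Icc 1 M).filter (fun N : ℕ => (N : ℤ) ≡ a [ZMOD Q₁] ∧ (N₂ : ℝ) - Δ ≤ N ∧
            (N : ℝ) < N₂ + 1)).card : ℝ) ≤ 6 * (x ^ (1 - ε) / Q₁) := by
        have : 2 * x ^ (1 - ε) / Q₁ = 2 * (x ^ (1 - ε) / Q₁) := by ring
        linarith only [hcard₁, hcard₂, hone, this]
      have hexp : x ^ δ * (x ^ (1 - ε) / Q₁) = x ^ (1 - ε / 2) / Q₁ := by
        rw [mul_div_assoc', hxadd]; congr 2; rw [hδdef]; ring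
      calc B₁ * (Cδ * (M : ℝ) ^ δ) * _ ≤ B₁ * (Cδ * (3 * x ^ δ)) * (6 * (x ^ (1 - ε) / Q₁)) := by
            gcongr
        _ = 18 * B₁ * Cδ * (x ^ δ * (x ^ (1 - ε) / Q₁)) := by ring
        _ = 18 * B₁ * Cδ * (x ^ (1 - ε / 2) / Q₁) := by rw [hexp]
    -- common prefactor of the `X`-terms
    have hq2 : (q : ℝ) ^ 2 ≤ x ^ (1 / 10 : ℝ) := by
      calc (q : ℝ) ^ 2 ≤ (x ^ (1 / 20 : ℝ)) ^ 2 := pow_le_pow_left₀ hq0.le hq20 2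
        _ = x ^ (1 / 10 : ℝ) := by
            rw [← Real.rpow_natCast, ← Real.rpow_mul hx0.le]; norm_num
    have hq₀2 : ((q₀ ^ 2 : ℕ) : ℝ) ≤ H ^ 2 * (q : ℝ) ^ 2 := by
      push_cast
      rw [← mul_pow]
      exact pow_le_pow_left₀ hq₀pos.le hq₀H 2
    have hpref : (q : ℝ) * (((q₀ ^ 2 : ℕ) : ℝ) * (Q.divisors.card : ℝ) / Q * (Q.divisors.card : ℝ)) ≤
        H ^ 2 * (q : ℝ) ^ 2 * Cδ ^ 2 * x ^ (2 * δ) / Q₁ := by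
      have h1 : (q : ℝ) * (((q₀ ^ 2 : ℕ) : ℝ) * (Q.divisors.card : ℝ) / Q * (Q.divisors.card : ℝ)) =
          ((q₀ ^ 2 : ℕ) : ℝ) * ((Q.divisors.card : ℝ) * (Q.divisors.card : ℝ)) / Q₁ := by
        rw [hQr]; field_simp
      rw [h1]
      have h2 : (Q.divisors.card : ℝ) * (Q.divisors.card : ℝ) ≤ (Cδ * x ^ δ) * (Cδ * x ^ δ) :=
        mul_le_mul hτQ hτQ (by positivity) (by positivity)
      have h3 : (Cδ * x ^ δ) * (Cδ * x ^ δ) = Cδ ^ 2 * x ^ (2 * δ) := by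
        rw [show 2 * δ = δ + δ from by ring, ← hxadd]; ring
      rw [h3] at h2
      calc ((q₀ ^ 2 : ℕ) : ℝ) * ((Q.divisors.card : ℝ) * (Q.divisors.card : ℝ)) / Q₁
          ≤ (H ^ 2 * (q : ℝ) ^ 2) * (Cδ ^ 2 * x ^ (2 * δ)) / Q₁ := by
            gcongr
        _ = _ := by ring
    -- `L₀ ≤ x` and `q²/L₀`
    have hL₀x : L₀ ≤ x := by
      rw [hL₀def]
      calc x ^ (ε₀ / 40 - 4 * ε) * (q : ℝ) ^ 2 ≤ x ^ (ε₀ / 40 - 4 * ε) * x ^ (1 / 10 : ℝ) :=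
            mul_le_mul_of_nonneg_left hq2 (hxpos _).le
        _ = x ^ (ε₀ / 40 - 4 * ε + 1 / 10) := hxadd _ _
        _ ≤ x ^ (1 : ℝ) := hmono _ _ (by rw [hεdef]; linarith only [hε₀1, hε₀])
        _ = x := hx_one
    have hqL₀ : (q : ℝ) ^ 2 / L₀ = x ^ (-(ε₀ / 40 - 4 * ε)) := by
      rw [hL₀def, Real.rpow_neg hx0.le]
      field_simp
    -- (T2) the trivial `X`-bound
    have hTB : B₁ * (Cδ * B ^ δ) * (B / L₀ + 2) ≤ B₁ * Cδ * (2 * x ^ δ) * (4 * x / L₀) := by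
      have h1 : B / L₀ + 2 ≤ 4 * x / L₀ := by
        rw [div_add' _ _ _ hL₀.ne', div_le_div_iff_of_pos_right hL₀]
        linarith only [hB2x, hL₀x]
      calc B₁ * (Cδ * B ^ δ) * (B / L₀ + 2) ≤ B₁ * (Cδ * (2 * x ^ δ)) * (4 * x / L₀) := by
            gcongr
        _ = _ := by ring
    have hT2 : (q : ℝ) * (((q₀ ^ 2 : ℕ) : ℝ) * (Q.divisors.card : ℝ) / Q * (Q.divisors.card : ℝ)) *
        (B₁ * (Cδ * B ^ δ) * (B / L₀ + 2)) ≤ 8 * B₁ * Cδ ^ 3 * H ^ 2 * (x ^ (1 - ε / 2) / Q₁) := by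
      calc (q : ℝ) * (((q₀ ^ 2 : ℕ) : ℝ) * (Q.divisors.card : ℝ) / Q * (Q.divisors.card : ℝ)) *
            (B₁ * (Cδ * B ^ δ) * (B / L₀ + 2))
          ≤ (H ^ 2 * (q : ℝ) ^ 2 * Cδ ^ 2 * x ^ (2 * δ) / Q₁) * (B₁ * Cδ * (2 * x ^ δ) * (4 * x / L₀)) :=
            mul_le_mul hpref hTB (by positivity) (by positivity)
        _ = 8 * B₁ * Cδ ^ 3 * H ^ 2 * (((q : ℝ) ^ 2 / L₀) * (x ^ (2 * δ) * x ^ δ * x) / Q₁) := by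
            field_simp
            ring
        _ = 8 * B₁ * Cδ ^ 3 * H ^ 2 * (x ^ (1 + 3 * δ + 4 * ε - ε₀ / 40) / Q₁) := by
            rw [hqL₀, hxadd, hxmul1, hxadd]
            congr 3; ring
        _ ≤ 8 * B₁ * Cδ ^ 3 * H ^ 2 * (x ^ (1 - ε / 2) / Q₁) := by
            gcongr 8 * B₁ * Cδ ^ 3 * H ^ 2 * (?_ / Q₁)
            exact hmono _ _ (by rw [hδdef, hεdef]; linarith only [hε₀])
    -- (T3) the Poisson `X`-bound
    have hexpU₀eq : Real.exp (-U₀) = x ^ (-(ε₀ / 20)) * ((q : ℝ) ^ 2)⁻¹ := by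
      rw [hU₀def, show -(ε₀ / 20 * Real.log x + 2 * Real.log q) =
        Real.log x * (-(ε₀ / 20)) + -(2 * Real.log q) by ring, Real.exp_add, ← Real.rpow_def_of_pos hx0,
        Real.exp_neg, show 2 * Real.log q = Real.log q + Real.log q by ring, Real.exp_add,
        Real.exp_log hq0, sq]
    have hLev : L₀ * Real.exp (-v) ≤ x ^ (-(ε₀ / 40)) := by
      calc L₀ * Real.exp (-v) ≤ L₀ * Real.exp (-U₀) :=
            mul_le_mul_of_nonneg_left (Real.exp_le_exp.mpr (by linarith only [hv.1])) hL₀.le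
        _ = x ^ (ε₀ / 40 - 4 * ε) * x ^ (-(ε₀ / 20)) := by
            rw [hexpU₀eq, hL₀def]; field_simp
        _ = x ^ (-(ε₀ / 40) - 4 * ε) := by rw [hxadd]; congr 1; ring
        _ ≤ x ^ (-(ε₀ / 40)) := hmono _ _ (by linarith only [hε])
    have hLev1 : L₀ * Real.exp (v + 1) / Δ ≤ Real.exp 1 * x ^ (-(ε₀ / 40)) := by
      have h1 : Real.exp (v + 1) ≤ Real.exp 1 * x * Real.exp (-U₀) := by
        calc Real.exp (v + 1) ≤ Real.exp (1 + X + -U₀) := Real.exp_le_exp.mpr (by linarith only [hvX])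
          _ = Real.exp 1 * x * Real.exp (-U₀) := by
              rw [Real.exp_add, Real.exp_add, hXdef, Real.exp_log hx0]
      calc L₀ * Real.exp (v + 1) / Δ ≤ L₀ * (Real.exp 1 * x * Real.exp (-U₀)) / Δ := by
            gcongr
        _ = Real.exp 1 * (x ^ (ε₀ / 40 - 4 * ε) * x * x ^ (-(ε₀ / 20)) / x ^ (1 - 2 * ε)) := by
            rw [hexpU₀eq, hL₀def, hΔdef]; field_simp
        _ = Real.exp 1 * x ^ (-(ε₀ / 40) - 2 * ε) := by
            congr 1
            rw [div_eq_iff (hxpos _).ne', hxmul1, hxadd, hxadd]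
            congr 1; ring
        _ ≤ Real.exp 1 * x ^ (-(ε₀ / 40)) :=
            mul_le_mul_of_nonneg_left (hmono _ _ (by linarith only [hε])) (Real.exp_pos 1).le
    have hxm5 : (x ^ (-(ε₀ / 40))) ^ m ≤ x ^ (-(5 : ℝ)) := by
      rw [← Real.rpow_natCast, ← Real.rpow_mul hx0.le]
      exact hmono _ _ (by nlinarith only [hmε])
    have hLevm : (L₀ * Real.exp (-v)) ^ m ≤ x ^ (-(5 : ℝ)) :=
      (pow_le_pow_left₀ (by positivity) hLev m).trans hxm5
    have hLev1m : (L₀ * Real.exp (v + 1) / Δ) ^ m ≤ Real.exp 1 ^ m * x ^ (-(5 : ℝ)) := by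
      calc (L₀ * Real.exp (v + 1) / Δ) ^ m ≤ (Real.exp 1 * x ^ (-(ε₀ / 40))) ^ m :=
            pow_le_pow_left₀ (by positivity) hLev1 m
        _ = Real.exp 1 ^ m * (x ^ (-(ε₀ / 40))) ^ m := mul_pow _ _ _
        _ ≤ Real.exp 1 ^ m * x ^ (-(5 : ℝ)) := mul_le_mul_of_nonneg_left hxm5 (by positivity)
    have hPB : C₁ * (B - A) * (Im * L₀ ^ m * Real.exp (-v) ^ m + B₁ * Km * (L₀ * Real.exp (v + 1) / Δ) ^ m) ≤
        2 * C₁ * (Im + B₁ * Km * Real.exp 1 ^ m) * (x * x ^ (-(5 : ℝ))) := by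
      have hBA2 : B - A ≤ 2 * x := by linarith only [hB2x, hA0]
      have hBA0 : 0 ≤ B - A := by linarith only [hAB]
      have h1 : Im * L₀ ^ m * Real.exp (-v) ^ m ≤ Im * x ^ (-(5 : ℝ)) := by
        rw [mul_assoc, ← mul_pow]; exact mul_le_mul_of_nonneg_left hLevm hIm
      have h2 : B₁ * Km * (L₀ * Real.exp (v + 1) / Δ) ^ m ≤ B₁ * Km * (Real.exp 1 ^ m * x ^ (-(5 : ℝ))) :=
        mul_le_mul_of_nonneg_left hLev1m (by positivity)
      calc C₁ * (B - A) * (Im * L₀ ^ m * Real.exp (-v) ^ m + B₁ * Km * (L₀ * Real.exp (v + 1) / Δ) ^ m)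
          ≤ C₁ * (2 * x) * (Im * x ^ (-(5 : ℝ)) + B₁ * Km * (Real.exp 1 ^ m * x ^ (-(5 : ℝ)))) := by
            refine mul_le_mul (mul_le_mul_of_nonneg_left hBA2 hC₁0) (add_le_add h1 h2) ?_ (by positivity)
            positivity
        _ = _ := by ring
    have hT3 : (q : ℝ) * (((q₀ ^ 2 : ℕ) : ℝ) * (Q.divisors.card : ℝ) / Q * (Q.divisors.card : ℝ)) *
        (C₁ * (B - A) * (Im * L₀ ^ m * Real.exp (-v) ^ m + B₁ * Km * (L₀ * Real.exp (v + 1) / Δ) ^ m)) ≤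
        2 * C₁ * Cδ ^ 2 * H ^ 2 * (Im + B₁ * Km * Real.exp 1 ^ m) * (x ^ (1 - ε / 2) / Q₁) := by
      have hPB0 : 0 ≤ C₁ * (B - A) * (Im * L₀ ^ m * Real.exp (-v) ^ m +
          B₁ * Km * (L₀ * Real.exp (v + 1) / Δ) ^ m) := by
        have hBA0 : 0 ≤ B - A := by linarith only [hAB]
        positivity
      calc (q : ℝ) * (((q₀ ^ 2 : ℕ) : ℝ) * (Q.divisors.card : ℝ) / Q * (Q.divisors.card : ℝ)) *
            (C₁ * (B - A) * (Im * L₀ ^ m * Real.exp (-v) ^ m + B₁ * Km * (L₀ * Real.exp (v + 1) / Δ) ^ m))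
          ≤ (H ^ 2 * (q : ℝ) ^ 2 * Cδ ^ 2 * x ^ (2 * δ) / Q₁) *
              (2 * C₁ * (Im + B₁ * Km * Real.exp 1 ^ m) * (x * x ^ (-(5 : ℝ)))) :=
            mul_le_mul hpref hPB hPB0 (by positivity)
        _ = 2 * C₁ * Cδ ^ 2 * H ^ 2 * (Im + B₁ * Km * Real.exp 1 ^ m) *
              ((q : ℝ) ^ 2 * (x ^ (2 * δ) * x * x ^ (-(5 : ℝ))) / Q₁) := by ring
        _ ≤ 2 * C₁ * Cδ ^ 2 * H ^ 2 * (Im + B₁ * Km * Real.exp 1 ^ m) *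
              (x ^ (1 / 10 : ℝ) * (x ^ (2 * δ) * x * x ^ (-(5 : ℝ))) / Q₁) := by
            gcongr
        _ = 2 * C₁ * Cδ ^ 2 * H ^ 2 * (Im + B₁ * Km * Real.exp 1 ^ m) *
              (x ^ (1 / 10 + 2 * δ + 1 - 5) / Q₁) := by
            rw [hxmul1, hxadd, hxadd]
            congr 3; ring
        _ ≤ 2 * C₁ * Cδ ^ 2 * H ^ 2 * (Im + B₁ * Km * Real.exp 1 ^ m) * (x ^ (1 - ε / 2) / Q₁) := by
            gcongr 2 * C₁ * Cδ ^ 2 * H ^ 2 * (Im + B₁ * Km * Real.exp 1 ^ m) * (?_ / Q₁)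
            exact hmono _ _ (by rw [hδdef]; linarith only [hεsmall, hε])
    -- (T4) the `Y`-bound
    have hΔinv : Δ⁻¹ = x ^ (2 * ε - 1) := by
      rw [hΔdef, ← Real.rpow_neg hx0.le]; congr 1; ring
    have hΔ2inv : (Δ ^ 2)⁻¹ = x ^ (4 * ε - 2) := by
      rw [hΔdef, ← Real.rpow_natCast, ← Real.rpow_mul hx0.le, ← Real.rpow_neg hx0.le]
      congr 1; push_cast; ring
    have hP : (2 * B₂ + B₁) * K₁ / Δ + B₁ * K₂ * (3 * x) / Δ ^ 2 ≤ CP * x ^ (4 * ε - 1) := by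
      have h1 : (2 * B₂ + B₁) * K₁ / Δ = (2 * B₂ + B₁) * K₁ * x ^ (2 * ε - 1) := by
        rw [div_eq_mul_inv, hΔinv]
      have h2 : B₁ * K₂ * (3 * x) / Δ ^ 2 = 3 * B₁ * K₂ * x ^ (4 * ε - 1) := by
        rw [div_eq_mul_inv, hΔ2inv, show B₁ * K₂ * (3 * x) * x ^ (4 * ε - 2) =
          3 * B₁ * K₂ * (x * x ^ (4 * ε - 2)) by ring, hx1mul]
        congr 2; ring
      rw [h1, h2, hCP]
      have h3 : x ^ (2 * ε - 1) ≤ x ^ (4 * ε - 1) := hmono _ _ (by linarith only [hε])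
      have h4 : 0 ≤ (2 * B₂ + B₁) * K₁ := by positivity
      nlinarith only [h3, h4]
    have h200 : 200 * x * ((2 * B₂ + B₁) * K₁ / Δ + B₁ * K₂ * (3 * x) / Δ ^ 2) ≤ 200 * CP * x ^ (4 * ε) := by
      calc 200 * x * ((2 * B₂ + B₁) * K₁ / Δ + B₁ * K₂ * (3 * x) / Δ ^ 2) ≤ 200 * x * (CP * x ^ (4 * ε - 1)) :=
            mul_le_mul_of_nonneg_left hP (by positivity)
        _ = 200 * CP * (x * x ^ (4 * ε - 1)) := by ring
        _ = 200 * CP * x ^ (4 * ε) := by rw [hx1mul]; congr 2; ring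
    -- the product `C_{3.8} · S`
    have hsqrtQ : (Q : ℝ) ^ 2 / ((Q : ℝ) * Real.sqrt Q) = Real.sqrt Q := by
      rw [sq, mul_div_mul_left _ _ hQpos.ne', Real.div_sqrt]
    have hL2 : (1 + Real.log Q) ^ 2 ≤ 4 * x ^ (2 * η) := by
      have hL0 : 0 ≤ 1 + Real.log Q := by
        have := Real.log_nonneg hQ1; linarith only [this]
      have hL1 : 1 + Real.log Q ≤ 2 * x ^ η := by
        have h1 : Real.log Q ≤ Real.log x := Real.log_le_log hQpos hQx
        have h2 : (1 : ℝ) ≤ x ^ η := hxge1 _ hη.le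
        linarith only [h1, h2, hlogle, hXdef]
      calc (1 + Real.log Q) ^ 2 ≤ (2 * x ^ η) ^ 2 := pow_le_pow_left₀ hL0 hL1 2
        _ = 4 * x ^ (2 * η) := by
            rw [mul_pow, ← Real.rpow_natCast (x ^ η), ← Real.rpow_mul hx0.le]; norm_num
            congr 1; ring
    have hsqrtH : Real.sqrt H ≤ H := by
      rw [Real.sqrt_le_iff]; exact ⟨by linarith only [hH1], by nlinarith only [hH1]⟩
    have hq₀32 : (q₀ : ℝ) * Real.sqrt q₀ ≤ H ^ 2 * (q : ℝ) * Real.sqrt q := by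
      have h1 : Real.sqrt q₀ ≤ H * Real.sqrt q := by
        calc Real.sqrt q₀ ≤ Real.sqrt (H * q) := Real.sqrt_le_sqrt hq₀H
          _ = Real.sqrt H * Real.sqrt q := Real.sqrt_mul (by linarith only [hH1]) _
          _ ≤ H * Real.sqrt q := mul_le_mul_of_nonneg_right hsqrtH (Real.sqrt_nonneg _)
      calc (q₀ : ℝ) * Real.sqrt q₀ ≤ (H * q) * (H * Real.sqrt q) :=
            mul_le_mul hq₀H h1 (Real.sqrt_nonneg _) (by positivity)
        _ = _ := by ring
    have hCS : (((q₀.divisors.card : ℕ) : ℝ) ^ 2 * ((q₀ : ℝ) * Real.sqrt q₀) * (Q.divisors.card : ℝ) /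
        ((Q : ℝ) * Real.sqrt Q)) * ((Q : ℝ) ^ 2 / 4 * (Q.divisors.card : ℝ) ^ 2 * (1 + Real.log Q) ^ 2) ≤
        Cδ ^ 5 * H ^ 2 * x ^ (5 * δ + 2 * η) * (q : ℝ) ^ 2 * Real.sqrt Q₁ := by
      have hrew : (((q₀.divisors.card : ℕ) : ℝ) ^ 2 * ((q₀ : ℝ) * Real.sqrt q₀) * (Q.divisors.card : ℝ) /
          ((Q : ℝ) * Real.sqrt Q)) * ((Q : ℝ) ^ 2 / 4 * (Q.divisors.card : ℝ) ^ 2 * (1 + Real.log Q) ^ 2) =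
          ((q₀.divisors.card : ℕ) : ℝ) ^ 2 * (Q.divisors.card : ℝ) ^ 3 * ((q₀ : ℝ) * Real.sqrt q₀) *
            (1 + Real.log Q) ^ 2 / 4 * ((Q : ℝ) ^ 2 / ((Q : ℝ) * Real.sqrt Q)) := by
        have : (Q : ℝ) * Real.sqrt Q ≠ 0 := by positivity
        field_simp
      have hsq : Real.sqrt Q = Real.sqrt Q₁ * Real.sqrt q := by
        rw [hQr, Real.sqrt_mul (Nat.cast_nonneg Q₁)]
      rw [hrew, hsqrtQ, hsq]
      have hτq₀2 : ((q₀.divisors.card : ℕ) : ℝ) ^ 2 ≤ (Cδ * x ^ δ) ^ 2 := pow_le_pow_left₀ (by positivity) hτq₀ 2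
      have hτQ3 : ((Q.divisors.card : ℕ) : ℝ) ^ 3 ≤ (Cδ * x ^ δ) ^ 3 := pow_le_pow_left₀ (by positivity) hτQ 3
      calc ((q₀.divisors.card : ℕ) : ℝ) ^ 2 * (Q.divisors.card : ℝ) ^ 3 * ((q₀ : ℝ) * Real.sqrt q₀) *
            (1 + Real.log Q) ^ 2 / 4 * (Real.sqrt Q₁ * Real.sqrt q)
          ≤ (Cδ * x ^ δ) ^ 2 * (Cδ * x ^ δ) ^ 3 * (H ^ 2 * (q : ℝ) * Real.sqrt q) *
            (4 * x ^ (2 * η)) / 4 * (Real.sqrt Q₁ * Real.sqrt q) := by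
            gcongr
        _ = Cδ ^ 5 * H ^ 2 * ((x ^ δ) ^ 5 * x ^ (2 * η)) * ((q : ℝ) * (Real.sqrt q * Real.sqrt q)) *
              Real.sqrt Q₁ := by ring
        _ = Cδ ^ 5 * H ^ 2 * x ^ (5 * δ + 2 * η) * (q : ℝ) ^ 2 * Real.sqrt Q₁ := by
            rw [Real.mul_self_sqrt hq0.le, ← Real.rpow_natCast (x ^ δ), ← Real.rpow_mul hx0.le, hxadd]
            congr 2
            · congr 1; push_cast; ring
            · ring
    have hsqrtQ₁ : Real.sqrt Q₁ ≤ x ^ (153 / 200 : ℝ) / Q₁ := by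
      rw [le_div_iff₀ hQ₁r]
      calc Real.sqrt Q₁ * Q₁ ≤ Real.sqrt (x ^ (51 / 100 : ℝ)) * x ^ (51 / 100 : ℝ) :=
            mul_le_mul (Real.sqrt_le_sqrt hQ₁x) hQ₁x (Nat.cast_nonneg _) (Real.sqrt_nonneg _)
        _ = x ^ (153 / 200 : ℝ) := by
            rw [Real.sqrt_eq_rpow, ← Real.rpow_mul hx0.le, hxadd]; norm_num
    have hq3 : (q : ℝ) ^ 3 ≤ x ^ (3 / 20 : ℝ) := by
      calc (q : ℝ) ^ 3 ≤ (x ^ (1 / 20 : ℝ)) ^ 3 := pow_le_pow_left₀ hq0.le hq20 3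
        _ = x ^ (3 / 20 : ℝ) := by
            rw [← Real.rpow_natCast, ← Real.rpow_mul hx0.le]; norm_num
    have hY : (q : ℝ) * (8 * (((q₀.divisors.card : ℕ) : ℝ) ^ 2 * ((q₀ : ℝ) * Real.sqrt q₀) *
        (Q.divisors.card : ℝ) / ((Q : ℝ) * Real.sqrt Q)) *
        (200 * x * ((2 * B₂ + B₁) * K₁ / Δ + B₁ * K₂ * (3 * x) / Δ ^ 2)) *
        ((Q : ℝ) ^ 2 / 4 * (Q.divisors.card : ℝ) ^ 2 * (1 + Real.log Q) ^ 2)) ≤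
        400 * Cδ ^ 5 * H ^ 2 * CP * 4 * (x ^ (1 - ε / 2) / Q₁) := by
      have hM'0 : 0 ≤ 200 * x * ((2 * B₂ + B₁) * K₁ / Δ + B₁ * K₂ * (3 * x) / Δ ^ 2) := by positivity
      calc (q : ℝ) * (8 * (((q₀.divisors.card : ℕ) : ℝ) ^ 2 * ((q₀ : ℝ) * Real.sqrt q₀) *
            (Q.divisors.card : ℝ) / ((Q : ℝ) * Real.sqrt Q)) *
            (200 * x * ((2 * B₂ + B₁) * K₁ / Δ + B₁ * K₂ * (3 * x) / Δ ^ 2)) *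
            ((Q : ℝ) ^ 2 / 4 * (Q.divisors.card : ℝ) ^ 2 * (1 + Real.log Q) ^ 2))
          = (q : ℝ) * 8 * ((((q₀.divisors.card : ℕ) : ℝ) ^ 2 * ((q₀ : ℝ) * Real.sqrt q₀) *
              (Q.divisors.card : ℝ) / ((Q : ℝ) * Real.sqrt Q)) *
              ((Q : ℝ) ^ 2 / 4 * (Q.divisors.card : ℝ) ^ 2 * (1 + Real.log Q) ^ 2)) *
              (200 * x * ((2 * B₂ + B₁) * K₁ / Δ + B₁ * K₂ * (3 * x) / Δ ^ 2)) := by ring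
        _ ≤ (q : ℝ) * 8 * (Cδ ^ 5 * H ^ 2 * x ^ (5 * δ + 2 * η) * (q : ℝ) ^ 2 * Real.sqrt Q₁) *
              (200 * CP * x ^ (4 * ε)) := by
            refine mul_le_mul (mul_le_mul_of_nonneg_left hCS (by positivity)) h200 hM'0 ?_
            positivity
        _ = 1600 * Cδ ^ 5 * H ^ 2 * CP * ((q : ℝ) ^ 3 * Real.sqrt Q₁ * (x ^ (5 * δ + 2 * η) * x ^ (4 * ε))) := by
            ring
        _ ≤ 1600 * Cδ ^ 5 * H ^ 2 * CP * (x ^ (3 / 20 : ℝ) * (x ^ (153 / 200 : ℝ) / Q₁) *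
              (x ^ (5 * δ + 2 * η) * x ^ (4 * ε))) := by
            gcongr
        _ = 1600 * Cδ ^ 5 * H ^ 2 * CP * (x ^ (3 / 20 + 153 / 200 + (5 * δ + 2 * η + 4 * ε)) / Q₁) := by
            rw [hxadd, mul_div_assoc', hxadd, div_mul_eq_mul_div, hxadd]
        _ ≤ 1600 * Cδ ^ 5 * H ^ 2 * CP * (x ^ (1 - ε / 2) / Q₁) := by
            gcongr 1600 * Cδ ^ 5 * H ^ 2 * CP * (?_ / Q₁)
            exact hmono _ _ (by rw [hδdef, hηdef]; linarith only [hεsmall, hε])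
        _ = 400 * Cδ ^ 5 * H ^ 2 * CP * 4 * (x ^ (1 - ε / 2) / Q₁) := by ring
    -- combine
    have hCsumr : 18 * B₁ * Cδ * (x ^ (1 - ε / 2) / Q₁) + 8 * B₁ * Cδ ^ 3 * H ^ 2 * (x ^ (1 - ε / 2) / Q₁) +
        2 * C₁ * Cδ ^ 2 * H ^ 2 * (Im + B₁ * Km * Real.exp 1 ^ m) * (x ^ (1 - ε / 2) / Q₁) +
        400 * Cδ ^ 5 * H ^ 2 * CP * 4 * (x ^ (1 - ε / 2) / Q₁) = CsumH * x ^ (1 - ε / 2) / Q₁ := by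
      rw [hCsumHdef]; ring
    rw [← hCsumr]
    linarith only [hT1, hT2, hT3, hY]
  -- the `t`-integral
  have hflat := abs_sum_mul_flatLog_le hφ hψ hBψ χ hU₀pos h2U₀ (Icc N₁ N₂) w hSv
  refine hflat.trans ?_
  -- `X³ ≤ x^{ε/4}`
  have hX3 : X ^ 3 ≤ x ^ (ε / 4) := by
    have h1 : X ≤ x ^ η := hlogle
    have h2 : X ^ 3 ≤ (x ^ η) ^ 3 := pow_le_pow_left₀ hlogx0 h1 3
    refine h2.trans (le_of_eq ?_)
    rw [← Real.rpow_natCast, ← Real.rpow_mul hx0.le]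
    congr 1
    rw [hηdef]; push_cast; ring
  have hQ₁r : (0 : ℝ) < Q₁ := by exact_mod_cast hQ₁
  have hBψ1 : 0 ≤ 1 + Bψ := by linarith only [hBψ0]
  calc (1 + Bψ) * X ^ 3 * (CsumH * x ^ (1 - ε / 2) / Q₁)
      ≤ (1 + Bψ) * x ^ (ε / 4) * ((Csum * H ^ 2) * x ^ (1 - ε / 2) / Q₁) := by
        gcongr
    _ = (1 + Bψ) * Csum * H ^ 2 * (x ^ (ε / 4) * x ^ (1 - ε / 2)) / Q₁ := by ring
    _ = (1 + Bψ) * Csum * H ^ 2 * x ^ (1 - ε / 4) / Q₁ := by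
        rw [hxadd]; congr 2; ring_nf

end TaoTeravainen

end Literature.Barriers.Parity
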